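import Summits.CriticalPhenomena.CardyFormulaZ2.Theorems.CardyMagicRigidityNestingRigidityFirstGenStoppingT
import HarnessLib

/-!
# Domain Markov property of the closed-b.c. site-`𝕋` domain ensemble, law form

Crux `Summit.CriticalPhenomena.CardyFormulaZ2.Theses.CardyMagicRigidity.NestingRigidity`
(stmt-CriticalPhenomena-4835), line `markov-cascade-one-generation`, registered helper (wave 4)
`firstGen_domLoopsT_markov` toward `stub_cascadeReconstruction`, over the definitions module
`CardyMagicRigidityMarkovCascadeDefs` (`PT`, `domLoopsT`, `firstGen`).

**Statement.** Fix `δ > 0`, a bounded domain `U`, a loop configuration `c₀`, and let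
`S = {x | ∃ u ∈ c₀.loops, u.wind (triMeshPoint δ x) ≠ 0 ∧ δ/2 < infDist (triMeshPoint δ x) u.range}`
be the set of sites STRICTLY INSIDE a loop of `c₀` and not read by it (the sites read by a honeycomb
interface loop are at distance exactly `δ/2` from its trace).  Then the event
`E = {firstGen (domLoopsT U δ ·) = c₀}` is independent, under critical site percolation
`PT = P_{1/2}`, of every measurable cylinder event `B = {ω | ω ∩ S ∈ A}` of the coordinates in `S`:
`PT (E ∩ B) = PT E * PT B`.  Conditionally on the first generation being `c₀`, the sites strictly
inside the first-generation loops carry fresh product site percolation.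

**Proof.** By the stopping-set lemma `firstGen_domLoopsT_eq_of_agree_outside` (module
`…FirstGenStoppingT`), `E` is determined by the coordinates in `Sᶜ`
(`firstGen_domLoopsT_inter_compl_eq_iff`: a site about which no loop of `c₀` winds, or within `δ/2`
of a trace, is not in `S`); `B` is determined by the coordinates in `S`; `E` is measurable because
`domLoopsT U δ` only reads the finitely many sites of `triMeshVertices U δ`
(`measurable_comp_inter_of_finite`); and two measurable events determined by disjoint families of
coordinates are independent under the product measure `sitePercolation` (module
`…OneGenerationTLocality`, `measureReal_inter_of_determined`, through `indep_iSup_of_disjoint`),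
here in `ℝ≥0∞` form (`sitePercolation_inter_eq_mul_of_determined`).
-/

noncomputable section

open Set Metric MeasureTheory ProbabilityTheory

namespace Summit.CriticalPhenomena.CardyFormulaZ2.Cruxes.NestingRigidity.MarkovCascadeOneGeneration

open Literature.Probability.RandomPlanarGeometry Literature.Probability.Percolation
  Literature.Probability.LatticeModels

/-- **Events determined by disjoint sets of sites are independent** under `sitePercolation V p`,
`ℝ≥0∞` form of `measureReal_inter_of_determined` (module `…OneGenerationTLocality`): no finiteness of
either family of sites is needed. -/
theorem sitePercolation_inter_eq_mul_of_determined {V : Type*} (p : unitInterval) {S T : Set V}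
    (hST : Disjoint S T) {A B : Set (SiteConfig V)} (hAm : MeasurableSet A) (hBm : MeasurableSet B)
    (hA : ∀ ω, ω ∩ S ∈ A ↔ ω ∈ A) (hB : ∀ ω, ω ∩ T ∈ B ↔ ω ∈ B) :
    sitePercolation V p (A ∩ B) = sitePercolation V p A * sitePercolation V p B := by
  have h := measureReal_inter_of_determined p hST hAm hBm hA hB
  simp only [measureReal_def] at h
  rwa [← ENNReal.toReal_mul, ENNReal.toReal_eq_toReal_iff' (measure_ne_top _ _)
    (ENNReal.mul_ne_top (measure_ne_top _ _) (measure_ne_top _ _))] at h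

/-- A site about which every loop of `c₀` has winding number `0`, or which is within `δ/2` of the
trace of each loop of `c₀` winding about it, is not strictly inside the loops of `c₀`. -/
theorem notMem_setOf_inside_of_forall {δ : ℝ} {c₀ : LoopConfig ℂ} {x : Site 2}
    (hx : ∀ u ∈ c₀.loops, u.wind (triMeshPoint δ x) = 0 ∨
      Metric.infDist (triMeshPoint δ x) u.range ≤ δ / 2) :
    x ∉ {x | ∃ u ∈ c₀.loops, u.wind (triMeshPoint δ x) ≠ 0 ∧
      δ / 2 < Metric.infDist (triMeshPoint δ x) u.range} := by
  rintro ⟨u, hu, hw, hd⟩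
  rcases hx u hu with h0 | hle
  · exact hw h0
  · exact (not_lt.2 hle) hd

/-- **`{firstGen (domLoopsT U δ ·) = c₀}` is determined by the coordinates NOT strictly inside the
loops of `c₀`** (`δ > 0`, `U` bounded): erasing the open sites strictly inside the loops of `c₀`
does not change whether the first generation is `c₀` — the stopping-set lemma
`firstGen_domLoopsT_eq_of_agree_outside`, applied from whichever of the two configurations has first
generation `c₀`. -/
theorem firstGen_domLoopsT_inter_compl_eq_iff {U : Set ℂ} {δ : ℝ} (hδ : 0 < δ)
    (hU : Bornology.IsBounded U) (c₀ : LoopConfig ℂ) (ω : SiteConfig (Site 2)) :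
    firstGen (domLoopsT U δ (ω ∩ {x | ∃ u ∈ c₀.loops, u.wind (triMeshPoint δ x) ≠ 0 ∧
        δ / 2 < Metric.infDist (triMeshPoint δ x) u.range}ᶜ)) = c₀ ↔
      firstGen (domLoopsT U δ ω) = c₀ := by
  set S : Set (Site 2) := {x | ∃ u ∈ c₀.loops, u.wind (triMeshPoint δ x) ≠ 0 ∧
    δ / 2 < Metric.infDist (triMeshPoint δ x) u.range} with hS
  constructor <;> intro h
  · refine (firstGen_domLoopsT_eq_of_agree_outside U δ (ω ∩ Sᶜ) ω hδ hU fun x hx ↦ ?_).trans h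
    rw [h] at hx
    exact ⟨fun h' ↦ h'.1, fun h' ↦ ⟨h', notMem_setOf_inside_of_forall hx⟩⟩
  · refine (firstGen_domLoopsT_eq_of_agree_outside U δ ω (ω ∩ Sᶜ) hδ hU fun x hx ↦ ?_).trans h
    rw [h] at hx
    exact ⟨fun h' ↦ ⟨h', notMem_setOf_inside_of_forall hx⟩, fun h' ↦ h'.1⟩

/-- **`{firstGen (domLoopsT U δ ·) = c₀}` is measurable** (`δ > 0`, `U` bounded): the domain
ensemble only reads the finitely many sites of `triMeshVertices U δ`. -/
theorem measurableSet_firstGen_domLoopsT_eq {U : Set ℂ} {δ : ℝ} (hδ : 0 < δ)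
    (hU : Bornology.IsBounded U) (c₀ : LoopConfig ℂ) :
    MeasurableSet {ω : SiteConfig (Site 2) | firstGen (domLoopsT U δ ω) = c₀} :=
  measurableSet_setOf.2 (measurable_comp_inter_of_finite (triMeshVertices_finite_holds hU hδ)
    fun β : SiteConfig (Site 2) ↦ firstGen (siteLoopConfig δ β) = c₀)

/-- **Domain Markov property of the closed-b.c. site-`𝕋` domain ensemble, law form** (registered
helper `firstGen_domLoopsT_markov`, wave 4, toward `stub_cascadeReconstruction`): for `δ > 0` and
bounded `U`, the event that the first generation of `domLoopsT U δ` equals `c₀` is independent,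
under critical site percolation `PT`, of every measurable event of the coordinates strictly inside
the loops of `c₀` (and not within `δ/2` of their traces) — given the first generation, these sites
are fresh product site percolation. -/
theorem firstGen_domLoopsT_markov : ∀ (U : Set ℂ) (δ : ℝ) (c₀ : LoopConfig ℂ) (A : Set (Set (Site 2))), 0 < δ → Bornology.IsBounded U → MeasurableSet {ω : SiteConfig (Site 2) | ω ∩ {x | ∃ u ∈ c₀.loops, u.wind (triMeshPoint δ x) ≠ 0 ∧ δ / 2 < Metric.infDist (triMeshPoint δ x) u.range} ∈ A} → PT ({ω | firstGen (domLoopsT U δ ω) = c₀} ∩ {ω | ω ∩ {x | ∃ u ∈ c₀.loops, u.wind (triMeshPoint δ x) ≠ 0 ∧ δ / 2 < Metric.infDist (triMeshPoint δ x) u.range} ∈ A}) = PT {ω | firstGen (domLoopsT U δ ω) = c₀} * PT {ω | ω ∩ {x | ∃ u ∈ c₀.loops, u.wind (triMeshPoint δ x) ≠ 0 ∧ δ / 2 < Metric.infDist (triMeshPoint δ x) u.range} ∈ A} := by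
  intro U δ c₀ A hδ hU hBm
  exact sitePercolation_inter_eq_mul_of_determined (V := Site 2) _ disjoint_compl_left
    (measurableSet_firstGen_domLoopsT_eq hδ hU c₀) hBm
    (fun ω ↦ firstGen_domLoopsT_inter_compl_eq_iff hδ hU c₀ ω)
    (fun ω ↦ by rw [mem_setOf_eq, mem_setOf_eq, inter_assoc, inter_self])

end Summit.CriticalPhenomena.CardyFormulaZ2.Cruxes.NestingRigidity.MarkovCascadeOneGeneration

end
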